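import Summits.BirchSwinnertonDyer.Rank1Residual.X2.CongruenceTransferCoveredNonsplit
import Literature.NumberTheory.EllipticCurves.Wuthrich2014.ShaBoundProofs
import Literature.NumberTheory.EllipticCurves.Wuthrich2014.MainConjectureConverseProofs
import Literature.NumberTheory.EllipticCurves.Rank1Residual.X1MainConjecture
import HarnessLib

/-!
# Class X2: ROUTE G WITH A CLOSED GOOD-ORDINARY `Ш`-UNIT RELATIVE — the `hA`-FREE non-split road
# (cell `bsd-eis`, seat `bsd-eis-k5-c3` g3; planner task Q-g15-2′ (i), memo
# `HOME/Q2-HAFREE-NONSPLIT-FINDING.md`; companion of `X2/CongruenceTransferCoveredNonsplit.lean`)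

HONEST FRAMING (FULL-BSD rank-≤1 programme D-0033, cell `bsd-eis`, home
`run/shared/lean/pub/bsd-eis/`; row A10 = corner X2b: `(E₀, 3)`, `r = 0`, multiplicative Eisenstein
`3`, `¬GVPar`). Nothing booked, no label moves; the class-wide crux `MazurMCOnCellB`
(stmt-BirchSwinnertonDyer-19033) is NOT touched — this is the per-pair CERTIFICATE road. Theorems only
(no definition, no named fact, nothing asserted).

THE POINT. Route G at a NON-SPLIT multiplicative Eisenstein prime `p` of `E₀` transfers Mazur's main
conjecture from a `p`-congruent GOOD relative `E₀'` (`E₀'[p] ≅ E₀[p]`); such a relative is ordinary,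
Eisenstein and NON-anomalous, and the tree's covered road (`X2/CongruenceTransferCovered*.lean`) takes
ITS main conjecture from Castella–Grossi–Skinner 2025 Thm. A (binder `hA`, flag of record
`CGS25-BST-Thm311`: the printed proof rests on the preprint [BSTW, §5]). When the relative is moreover
CLOSED — `r_an(E₀') = 0` and `p ∤ #Ш(E₀'/ℚ)_an` — its main conjecture is instead a THEOREM OF THE
REFEREED RECORD by the converse chain, which never uses anomaly:
Wuthrich 2014 Prop. 21 (`sha_dvd_analyticSha`: `#Ш(E₀')[p^∞] ∣ #Ш_an`, so `BSD(E₀', p)`) ⟹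
Wuthrich 2014 Thm. 16 (`charIdeal_dvd_padicLFunction`, Kato's divisibility) + Greenberg 1999 Thm. 4.1
(`greenberg_charValue_rankZero`) ⟹ the cofactor is a unit of `Λ` ⟹ `MazurMainConjecture E₀' p`
(tree: `Wuthrich2014.mainConjecture_of_bsdp`, stated so far only on `ClassX1`, whose definition carries
anomaly). This file states the anomaly-free composite and plugs it into gen 7's closed-relative road:

* §1 `mazurMainConjecture_of_shaAn_unit_of_goodOrdinary` (+ `_of_good_red`, `_of_analyticRank_eq_zero`)
  — per pair: `p ≠ 2` good ordinary, `E[p]` reducible, `L(E,1) ≠ 0`, `p ∤ #Ш_an` ⟹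
  `MazurMainConjecture W p`, from `hW21 hW16 hGr hGZK` (all PUBLISHED, all binders of the K5 route's
  `PublishedInputs`);
* §2 `mazurMainConjectureAt_of_shaUnitRelative_of_not_split`, `bsdp_of_shaUnitRelative_rankZero_of_not_split`,
  `missingInputB_of_shaUnitRelative_of_not_split` — the NON-SPLIT covered heads of the companion file
  with `hA` REPLACED by `hW21 + hGr + hGZK` (class level, refereed) `+ hr' + hunit'` (per pair,
  instrument: `r_an(E₀') = 0` [Cremona/PARI], `3 ∤ #Ш(E₀')_an` [two implementations]); `hred'` is
  discharged by the congruence, `hord'` by Serre 1972 Prop. 12, `L(E₀',1) ≠ 0` by modularity (`hpar`).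

Binder delta versus the booked T-EISRG3C shape: `− hA + hW21 + hGr (+ hGZK on the MC head) + hr' + hunit'`
= the B8 «T-EISRG3X» currency. Census (planner g15, kit j250907, two engines, levels ≤ 4): the ten
non-split A10 pairs `5568g1/72384k1 ← 287680y1`, `91650h1/91650i1 ← 354850l1`, `169932bd1 ← 271082i1`,
`179520gz1 ← 24640w1`, `194025s1 ← 109450k1`, `235200oj1 ← 172480bd1`, `494508k1 ← 117740k1`,
`358050a1 ← 2450t1` all close with equality `n = n' + Σ(δ' − δ)`.

References: [Wuthrich2014] Thm. 16 (p. 397), Prop. 21 (p. 400); [GreenbergLNM1716] Thm. 4.1;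
[GreenbergVatsal2000] Thm. (1.4), §1 (5)–(7), §2 pp. 20–27; [SteinWuthrich2013] Thm. 6.1;
[Serre1972] §1.11 Prop. 12; [Miller2011LMS] Def. 1.1; HOME/Q2-HAFREE-NONSPLIT-FINDING.md §2.
-/

set_option autoImplicit false

noncomputable section

open scoped Classical MatrixGroups ModularForm

open PowerSeries CongruenceSubgroup WeierstrassCurve NumberField IsDedekindDomain
  Literature.NumberTheory.EllipticCurves
  Literature.NumberTheory.EllipticCurves.ModularForms
  Literature.NumberTheory.EllipticCurves.Rank1Residual
  Literature.NumberTheory.EllipticCurves.Rank1Residual.Typed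
  Literature.NumberTheory.EllipticCurves.Wuthrich2014
  Literature.NumberTheory.EllipticCurves.SteinWuthrich2013
  Literature.NumberTheory.EllipticCurves.Greenberg1999
  Literature.NumberTheory.EllipticCurves.GreenbergVatsal2000
  Summit.BirchSwinnertonDyer.BirchSwinnertonDyer.Theorems.Rank1ResidualX1Defs
  Summit.BirchSwinnertonDyer.Rank1Residual.X1.MuLambda
  Summit.BirchSwinnertonDyer.Rank1Residual.X1.MuPart
  Summit.BirchSwinnertonDyer.Rank1Residual.X1.ParitySqueeze
  Summit.BirchSwinnertonDyer.Rank1Residual.X1.TamagawaSqueeze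
  Summit.BirchSwinnertonDyer.Rank1Residual.X1.CongruenceTransfer
  Summit.BirchSwinnertonDyer.Rank1Residual.X2.CongruentLambdaShiftMultiplicative

namespace Summit.BirchSwinnertonDyer.Rank1Residual.X2

/-! ## §1. The closed good-ordinary relative: `p ∤ #Ш_an` ⟹ `MazurMainConjecture` (anomaly-free) -/

section Converse

variable (W : WeierstrassCurve ℚ) [W.IsElliptic] [W.IsGloballyMinimal] (p : ℕ) [Fact p.Prime]

/-- **Per pair, anomaly-free: `p ∤ #Ш(E/ℚ)_an` ⟹ `MazurMainConjecture W p`** for `W/ℚ` globally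
minimal, `p ≠ 2` a prime of GOOD ORDINARY reduction with `E[p]` REDUCIBLE and `L(E,1) ≠ 0`. Chain:
Wuthrich 2014 Prop. 21 (`hW21`, with Gross–Zagier–Kolyvagin `hGZK`) gives Miller's `BSD(E,p)`
(`bsdp_of_L_one_ne_zero_of_padicValRat_shaAn_eq_zero`; good ⇒ not additive); then the converse of
Wuthrich Thm. 16 + Greenberg Thm. 4.1 (`Wuthrich2014.mainConjecture_of_bsdp`, `hW16 hGr`). The same
composite is `Rank1ResidualX1Converse.mazurMainConjecture_of_shaAn_unit` on `ClassX1` (anomalous by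
definition of the class, not by need of the proof); here NO anomaly hypothesis — the shape needed by a
good relative of a NON-SPLIT multiplicative target (`a_p ≡ −1 (mod p)`).
[cite: Wuthrich2014, Thm. 16 (p. 397) and Prop. 21 (p. 400)] [cite: GreenbergLNM1716, Thm. 4.1]
[cite: Miller2011LMS, Def. 1.1 (arXiv:1010.2431 p. 3)] -/
theorem mazurMainConjecture_of_shaAn_unit_of_goodOrdinary (hW21 : sha_dvd_analyticSha)
    (hW16 : Wuthrich2014.charIdeal_dvd_padicLFunction) (hGr : greenberg_charValue_rankZero)
    (hGZK : rank_eq_analyticRank_of_analyticRank_le_one) (hp2 : p ≠ 2)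
    (hgood : W.HasGoodReductionAtPrime p) (hord : ¬ (p : ℤ) ∣ W.frobeniusTrace p)
    (hred : ¬ W.HasIrreducibleModPGaloisRep p) (hL : W.entireLFunction 1 ≠ 0)
    (hunit : ∃ q : ℚ, shaAn W = (q : ℂ) ∧ padicValRat p q = 0) : MazurMainConjecture W p := by
  intro κ γ hκ hγ hγ' _ f hf ϖ hϖ D
  exact Wuthrich2014.mainConjecture_of_bsdp hW16 hGr hGZK W p hp2 hgood hord hred hL
    (bsdp_of_L_one_ne_zero_of_padicValRat_shaAn_eq_zero hW21 hGZK W p hp2 hL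
      (WeierstrassCurve.HasGoodReduction.not_hasAdditiveReduction (R := ℤ_[p]) hgood) (Or.inl hred)
      hunit) hκ hγ hγ' hf D ϖ hϖ

/-- **The same with ordinarity DISCHARGED**: a good Eisenstein prime `p > 2` is ordinary (Serre 1972
§1.11 Prop. 12, tree `goodOrd_of_red_of_good`). [cite: Serre1972, §1.11 Prop. 12]
[cite: Wuthrich2014, Thm. 16 (p. 397) and Prop. 21 (p. 400)] [cite: GreenbergLNM1716, Thm. 4.1] -/
theorem mazurMainConjecture_of_shaAn_unit_of_good_red (hW21 : sha_dvd_analyticSha)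
    (hW16 : Wuthrich2014.charIdeal_dvd_padicLFunction) (hGr : greenberg_charValue_rankZero)
    (hGZK : rank_eq_analyticRank_of_analyticRank_le_one) (hp2 : p ≠ 2)
    (hgood : W.HasGoodReductionAtPrime p) (hred : ¬ W.HasIrreducibleModPGaloisRep p)
    (hL : W.entireLFunction 1 ≠ 0) (hunit : ∃ q : ℚ, shaAn W = (q : ℂ) ∧ padicValRat p q = 0) :
    MazurMainConjecture W p :=
  have hp : 2 < p := by
    have h2 := (Fact.out : p.Prime).two_le
    omega
  mazurMainConjecture_of_shaAn_unit_of_goodOrdinary W p hW21 hW16 hGr hGZK hp2 hgood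
    (not_dvd_frobeniusTrace_of_red_of_good W p hp hgood hred) hred hL hunit

/-- **Census shape (`r_an = 0` instead of `L(E,1) ≠ 0`)**: modularity with an integral Manin constant
(`hpar`) converts `ord_{s=1} L(E,s) = 0` into `L(E,1) ≠ 0`; the rest as above. This is the binder
set of the `hA`-free displays: class level `hW21 hW16 hGr hGZK hpar`, per pair `hgood hred`
(kernel) and `hr0`, `hunit` (instrument). [cite: Wuthrich2014, Thm. 16 (p. 397) and Prop. 21 (p. 400)]
[cite: GreenbergLNM1716, Thm. 4.1] [cite: BCDTJAMS2001, Theorem A] -/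
theorem mazurMainConjecture_of_shaAn_unit_of_analyticRank_eq_zero (hW21 : sha_dvd_analyticSha)
    (hW16 : Wuthrich2014.charIdeal_dvd_padicLFunction) (hGr : greenberg_charValue_rankZero)
    (hGZK : rank_eq_analyticRank_of_analyticRank_le_one) (hpar : nonempty_modularParametrizationData)
    (hp2 : p ≠ 2) (hgood : W.HasGoodReductionAtPrime p) (hred : ¬ W.HasIrreducibleModPGaloisRep p)
    (hr0 : W.analyticRank = 0) (hunit : ∃ q : ℚ, shaAn W = (q : ℂ) ∧ padicValRat p q = 0) :
    MazurMainConjecture W p :=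
  mazurMainConjecture_of_shaAn_unit_of_good_red W p hW21 hW16 hGr hGZK hp2 hgood hred
    (entireLFunction_one_ne_zero_of_analyticRank_eq_zero hpar W hr0) hunit

end Converse

/-! ## §2. NON-SPLIT X2 target, closed good `Ш`-unit relative: the `hA`-free heads -/

section NonSplit

variable {W W' : WeierstrassCurve ℚ} [W.IsElliptic] [W.IsGloballyMinimal]
  [W'.IsElliptic] [W'.IsGloballyMinimal] {p : ℕ} [Fact p.Prime]
  (S₀ : Finset (HeightOneSpectrum (𝓞 ℚ)))

/-- **X2 target, closed good `Ш`-unit relative ⇒ `(μ_alg, λ_alg)(E₀) = (0, k)`, shift DERIVED, no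
`hA`.** Target `(E₀, p)`: `p ≠ 2` multiplicative, `E₀[p]` reducible, `μ_an(E₀) = 0`. Relative
`(E₀', p)`: GOOD (hence ordinary — Serre; Eisenstein — by the congruence), `r_an(E₀') = 0`,
`p ∤ #Ш(E₀')_an` (so `MazurMainConjecture E₀' p` by §1), analytic certificates `μ_an = 0`, `λ_an = n'`;
congruence `E₀[p] ≅ E₀'[p]`; `Σ₀ ∌ p` a finite set off which both curves have good reduction;
`k = n' + Σ_{v∈Σ₀}(δ' − δ) − e_p(E₀)`. Gen 13's derived shift
(`congruentLambdaShift_mult_goodOrd_of_facts`: Tate A40/A41, GV (5)–(7), Prop. 2.5, pp. 8/15/26) +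
gen 7's `algebraicInvariantsEq_of_closedRelative_goodOrd`.
[cite: GreenbergVatsal2000, Thm. (1.4), §1 (5)–(7), pp. 14–15, §2 pp. 20–27]
[cite: Wuthrich2014, Thm. 16 (p. 397) and Prop. 21 (p. 400)] [cite: GreenbergLNM1716, Thm. 4.1] -/
theorem algebraicInvariantsEq_of_shaUnitRelative_of_facts (hW21 : sha_dvd_analyticSha)
    (hGr : greenberg_charValue_rankZero) (hGZK : rank_eq_analyticRank_of_analyticRank_le_one)
    (hWu : thm16_charIdeal_dvd_multiplicative_of_reducible)
    (hW16 : Wuthrich2014.charIdeal_dvd_padicLFunction)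
    (hpar : nonempty_modularParametrizationData)
    (hT : Silverman1994_thmV53_corV54_tateUniformisation.{0})
    (hT' : Silverman1994_thmV53_tateUniformisation.{0})
    (hAm : lambda_nonPrimitive_eq_add_sum_delta_multiplicative)
    (hBm : datumSelmer_divisible_of_finite_torsionBy) (hF : datumStrictSelmer_lt_datumSelmer_of_split)
    (hGV : imKummer_ge_greenbergCondition_at_p) (hA7 : lambda_nonPrimitive_eq_add_sum_delta)
    (hB : divisible_nonPrimitiveSelmerInfty_of_mu_eq_zero) (hp2 : p ≠ 2)
    (hmult : W.HasMultiplicativeReductionAtPrime p) (hred : ¬ W.HasIrreducibleModPGaloisRep p)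
    (hμ0 : AnalyticMuLE W p 0) (hgood' : W'.HasGoodReductionAtPrime p) (hr' : W'.analyticRank = 0)
    (hunit' : ∃ q : ℚ, shaAn W' = (q : ℂ) ∧ padicValRat p q = 0) {n' : ℕ}
    (hμ0' : X1.MuPart.AnalyticMuLE W' p 0) (hlam' : X1.ParitySqueeze.AnalyticLambdaEq W' p n')
    (hS₀ : ∀ v ∈ S₀, ((p : ℕ) : 𝓞 ℚ) ∉ v.asIdeal)
    (hS : ∀ v : HeightOneSpectrum (𝓞 ℚ), v ∉ S₀ → ((p : ℕ) : 𝓞 ℚ) ∉ v.asIdeal →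
      W.HasGoodReductionAt v)
    (hS' : ∀ v : HeightOneSpectrum (𝓞 ℚ), v ∉ S₀ → ((p : ℕ) : 𝓞 ℚ) ∉ v.asIdeal →
      W'.HasGoodReductionAt v)
    (hiso : TorsionIso W W' p) {k : ℕ}
    (hk : (k : ℤ) = n' + (∑ v ∈ S₀, ((delta W' p v : ℤ) - (delta W p v : ℤ)) -
      (if W.HasSplitMultiplicativeReductionAtPrime p then 1 else 0))) :
    AlgebraicInvariantsEq W p k :=
  have hp : 2 < p := by
    have h2 := (Fact.out : p.Prime).two_le
    omega
  have hred' : ¬ W'.HasIrreducibleModPGaloisRep p := not_hasIrreducibleModPGaloisRep_of_torsionIso hiso hred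
  have hord' : ¬ (p : ℤ) ∣ W'.frobeniusTrace p := not_dvd_frobeniusTrace_of_red_of_good W' p hp hgood' hred'
  algebraicInvariantsEq_of_closedRelative_goodOrd hWu hW16 hpar hp2 hmult hred hμ0 hgood' hord' hred'
    (mazurMainConjecture_of_shaAn_unit_of_analyticRank_eq_zero W' p hW21 hW16 hGr hGZK hpar hp2 hgood'
      hred' hr' hunit') hμ0' hlam' hiso
    (CongruentLambdaShiftMultiplicative.congruentLambdaShift_mult_goodOrd_of_facts W W' S₀ hT hT' hAm
      hBm hF hGV hA7 hB hp2 hmult hgood' hord' hS₀ hS hS')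
    hk

/-- **NON-SPLIT X2 pair, closed good `Ш`-unit relative, shift DERIVED ⇒ Mazur's main conjecture at
the pair** (both ranks), with NO `hA`: `(E₀, p)` non-split multiplicative, `E₀[p]` reducible,
`p ≠ 2`, `μ_an(E₀) = 0`, `λ_an(E₀) = n`; `(E₀', p)` good, `r_an(E₀') = 0`, `p ∤ #Ш(E₀')_an`,
`μ_an = 0`, `λ_an = n'`; `E₀[p] ≅ E₀'[p]`; `Σ₀ ∌ p` ⊇ bad primes of both; and the ONE integer
inequality `n ≤ n' + Σ_{v∈Σ₀}(δ_{E₀'}^{(v)} − δ_{E₀}^{(v)})` (then `=`). Inputs beyond certificates: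
Wuthrich 2014 Thm. 16 (both forms) and Prop. 21, Greenberg 1999 Thm. 4.1, GZK, modularity, Tate's
uniformisation (A40/A41) and the Greenberg–Vatsal §1–§2 statements — ALL REFEREED; no
Castella–Grossi–Skinner / [BSTW] input. [cite: Wuthrich2014, Thm. 16 (p. 397) and Prop. 21 (p. 400)]
[cite: GreenbergLNM1716, Thm. 4.1] [cite: GreenbergVatsal2000, Thm. (1.4), §1 (5)–(7), pp. 14–15, §2 pp. 20–27] -/
theorem mazurMainConjectureAt_of_shaUnitRelative_of_not_split (hW21 : sha_dvd_analyticSha)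
    (hGr : greenberg_charValue_rankZero) (hGZK : rank_eq_analyticRank_of_analyticRank_le_one)
    (hWu : thm16_charIdeal_dvd_multiplicative_of_reducible)
    (hW16 : Wuthrich2014.charIdeal_dvd_padicLFunction)
    (hpar : nonempty_modularParametrizationData)
    (hT : Silverman1994_thmV53_corV54_tateUniformisation.{0})
    (hT' : Silverman1994_thmV53_tateUniformisation.{0})
    (hAm : lambda_nonPrimitive_eq_add_sum_delta_multiplicative)
    (hBm : datumSelmer_divisible_of_finite_torsionBy) (hF : datumStrictSelmer_lt_datumSelmer_of_split)
    (hGV : imKummer_ge_greenbergCondition_at_p) (hA7 : lambda_nonPrimitive_eq_add_sum_delta)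
    (hB : divisible_nonPrimitiveSelmerInfty_of_mu_eq_zero) (hp2 : p ≠ 2)
    (hmult : W.HasMultiplicativeReductionAtPrime p)
    (hns : ¬ W.HasSplitMultiplicativeReductionAtPrime p) (hred : ¬ W.HasIrreducibleModPGaloisRep p)
    {n : ℕ} (hμ0 : AnalyticMuLE W p 0) (hlam : AnalyticLambdaEq W p n)
    (hgood' : W'.HasGoodReductionAtPrime p) (hr' : W'.analyticRank = 0)
    (hunit' : ∃ q : ℚ, shaAn W' = (q : ℂ) ∧ padicValRat p q = 0) {n' : ℕ}
    (hμ0' : X1.MuPart.AnalyticMuLE W' p 0) (hlam' : X1.ParitySqueeze.AnalyticLambdaEq W' p n')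
    (hS₀ : ∀ v ∈ S₀, ((p : ℕ) : 𝓞 ℚ) ∉ v.asIdeal)
    (hS : ∀ v : HeightOneSpectrum (𝓞 ℚ), v ∉ S₀ → ((p : ℕ) : 𝓞 ℚ) ∉ v.asIdeal →
      W.HasGoodReductionAt v)
    (hS' : ∀ v : HeightOneSpectrum (𝓞 ℚ), v ∉ S₀ → ((p : ℕ) : 𝓞 ℚ) ∉ v.asIdeal →
      W'.HasGoodReductionAt v)
    (hiso : TorsionIso W W' p) {k : ℕ}
    (hk : (k : ℤ) = n' + ∑ v ∈ S₀, ((delta W' p v : ℤ) - (delta W p v : ℤ))) (hn : n ≤ k) :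
    X2.MazurMainConjectureAt W p :=
  mazurMainConjectureAt_of_algebraicInvariantsEq hWu W p hp2 hmult hred hμ0 hlam
    (algebraicInvariantsEq_of_shaUnitRelative_of_facts S₀ hW21 hGr hGZK hWu hW16 hpar hT hT' hAm hBm hF
      hGV hA7 hB hp2 hmult hred hμ0 hgood' hr' hunit' hμ0' hlam' hS₀ hS hS' hiso
      (by rw [if_neg hns, sub_zero]; exact hk))
    (fun _ ↦ hn) (fun h ↦ absurd h hns)

/-- **NON-SPLIT X2b pair (rank `0`), closed good `Ш`-unit relative, shift DERIVED ⇒ `BSD(E₀, p)`**,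
with NO `hA`. As above with `r_an(E₀) = 0`; the last step is gen 1's
`bsdp_of_mazurMainConjectureAt_of_analyticRank_eq_zero` (Stein–Wuthrich Thm. 6.1, Greenberg–Stevens,
GZK, modularity). [cite: Wuthrich2014, Thm. 16 (p. 397) and Prop. 21 (p. 400)]
[cite: GreenbergLNM1716, Thm. 4.1] [cite: GreenbergVatsal2000, Thm. (1.4), §1 (5)–(7), pp. 14–15, §2 pp. 20–27]
[cite: SteinWuthrich2013, Thm. 6.1 (p. 20)] -/
theorem bsdp_of_shaUnitRelative_rankZero_of_not_split (hW21 : sha_dvd_analyticSha)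
    (hGr : greenberg_charValue_rankZero)
    (hWu : thm16_charIdeal_dvd_multiplicative_of_reducible)
    (hW16 : Wuthrich2014.charIdeal_dvd_padicLFunction)
    (hJs : thm61_splitMultiplicative) (hJn : thm61_nonsplitMultiplicative)
    (hHs : exists_isSplitMultCanonical) (hHn : exists_isMultCanonical)
    (hGZK : rank_eq_analyticRank_of_analyticRank_le_one) (hmod : hasEntireLFunction_rat)
    (hpar : nonempty_modularParametrizationData)
    (hT : Silverman1994_thmV53_corV54_tateUniformisation.{0})
    (hT' : Silverman1994_thmV53_tateUniformisation.{0})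
    (hAm : lambda_nonPrimitive_eq_add_sum_delta_multiplicative)
    (hBm : datumSelmer_divisible_of_finite_torsionBy) (hF : datumStrictSelmer_lt_datumSelmer_of_split)
    (hGV : imKummer_ge_greenbergCondition_at_p) (hA7 : lambda_nonPrimitive_eq_add_sum_delta)
    (hB : divisible_nonPrimitiveSelmerInfty_of_mu_eq_zero)
    (W W' : WeierstrassCurve ℚ) [W.IsElliptic] [W.IsGloballyMinimal] [W'.IsElliptic]
    [W'.IsGloballyMinimal] (p : ℕ) [Fact p.Prime] (hGS : greenberg_stevens (W := W) (p := p))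
    (hp2 : p ≠ 2) (hmult : W.HasMultiplicativeReductionAtPrime p)
    (hns : ¬ W.HasSplitMultiplicativeReductionAtPrime p)
    (hred : ¬ W.HasIrreducibleModPGaloisRep p) (hr : W.analyticRank = 0) {n : ℕ}
    (hμ0 : AnalyticMuLE W p 0) (hlam : AnalyticLambdaEq W p n)
    (hgood' : W'.HasGoodReductionAtPrime p) (hr' : W'.analyticRank = 0)
    (hunit' : ∃ q : ℚ, shaAn W' = (q : ℂ) ∧ padicValRat p q = 0) {n' : ℕ}
    (hμ0' : X1.MuPart.AnalyticMuLE W' p 0) (hlam' : X1.ParitySqueeze.AnalyticLambdaEq W' p n')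
    (hS₀ : ∀ v ∈ S₀, ((p : ℕ) : 𝓞 ℚ) ∉ v.asIdeal)
    (hS : ∀ v : HeightOneSpectrum (𝓞 ℚ), v ∉ S₀ → ((p : ℕ) : 𝓞 ℚ) ∉ v.asIdeal →
      W.HasGoodReductionAt v)
    (hS' : ∀ v : HeightOneSpectrum (𝓞 ℚ), v ∉ S₀ → ((p : ℕ) : 𝓞 ℚ) ∉ v.asIdeal →
      W'.HasGoodReductionAt v)
    (hiso : TorsionIso W W' p) {k : ℕ}
    (hk : (k : ℤ) = n' + ∑ v ∈ S₀, ((delta W' p v : ℤ) - (delta W p v : ℤ))) (hn : n ≤ k) :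
    BSDp W p :=
  bsdp_of_mazurMainConjectureAt_of_analyticRank_eq_zero hJs hJn hHs hHn hGZK hmod hpar W p hGS hp2
    hmult hr (mazurMainConjectureAt_of_shaUnitRelative_of_not_split S₀ hW21 hGr hGZK hWu hW16 hpar hT
      hT' hAm hBm hF hGV hA7 hB hp2 hmult hns hred hμ0 hlam hgood' hr' hunit' hμ0' hlam' hS₀ hS hS'
      hiso hk hn)

/-- **NON-SPLIT X2b pair: its TYPED INPUT `MissingInputB W p` from a closed good `Ш`-unit relative**
(shift derived, no `hA`) — bookkeeping form for the Partition (`MissingInputB = X2.MazurMainConjectureAt`).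
[cite: Wuthrich2014, Thm. 16 (p. 397) and Prop. 21 (p. 400)] [cite: GreenbergLNM1716, Thm. 4.1]
[cite: GreenbergVatsal2000, Thm. (1.4), §2 pp. 26–27] -/
theorem missingInputB_of_shaUnitRelative_of_not_split (hW21 : sha_dvd_analyticSha)
    (hGr : greenberg_charValue_rankZero) (hGZK : rank_eq_analyticRank_of_analyticRank_le_one)
    (hWu : thm16_charIdeal_dvd_multiplicative_of_reducible)
    (hW16 : Wuthrich2014.charIdeal_dvd_padicLFunction)
    (hpar : nonempty_modularParametrizationData)
    (hT : Silverman1994_thmV53_corV54_tateUniformisation.{0})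
    (hT' : Silverman1994_thmV53_tateUniformisation.{0})
    (hAm : lambda_nonPrimitive_eq_add_sum_delta_multiplicative)
    (hBm : datumSelmer_divisible_of_finite_torsionBy) (hF : datumStrictSelmer_lt_datumSelmer_of_split)
    (hGV : imKummer_ge_greenbergCondition_at_p) (hA7 : lambda_nonPrimitive_eq_add_sum_delta)
    (hB : divisible_nonPrimitiveSelmerInfty_of_mu_eq_zero)
    (W W' : WeierstrassCurve ℚ) [W.IsElliptic] [W.IsGloballyMinimal] [W'.IsElliptic]
    [W'.IsGloballyMinimal] (p : ℕ) [Fact p.Prime] (hc : CellB W p)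
    (hns : ¬ W.HasSplitMultiplicativeReductionAtPrime p) {n : ℕ}
    (hμ0 : AnalyticMuLE W p 0) (hlam : AnalyticLambdaEq W p n)
    (hgood' : W'.HasGoodReductionAtPrime p) (hr' : W'.analyticRank = 0)
    (hunit' : ∃ q : ℚ, shaAn W' = (q : ℂ) ∧ padicValRat p q = 0) {n' : ℕ}
    (hμ0' : X1.MuPart.AnalyticMuLE W' p 0) (hlam' : X1.ParitySqueeze.AnalyticLambdaEq W' p n')
    (hS₀ : ∀ v ∈ S₀, ((p : ℕ) : 𝓞 ℚ) ∉ v.asIdeal)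
    (hS : ∀ v : HeightOneSpectrum (𝓞 ℚ), v ∉ S₀ → ((p : ℕ) : 𝓞 ℚ) ∉ v.asIdeal →
      W.HasGoodReductionAt v)
    (hS' : ∀ v : HeightOneSpectrum (𝓞 ℚ), v ∉ S₀ → ((p : ℕ) : 𝓞 ℚ) ∉ v.asIdeal →
      W'.HasGoodReductionAt v)
    (hiso : TorsionIso W W' p) {k : ℕ}
    (hk : (k : ℤ) = n' + ∑ v ∈ S₀, ((delta W' p v : ℤ) - (delta W p v : ℤ))) (hn : n ≤ k) :
    MissingInputB W p :=
  mazurMainConjectureAt_of_shaUnitRelative_of_not_split S₀ hW21 hGr hGZK hWu hW16 hpar hT hT' hAm hBm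
    hF hGV hA7 hB hc.2.1.1 hc.2.1.2.2 hns hc.2.1.2.1 hμ0 hlam hgood' hr' hunit' hμ0' hlam' hS₀ hS hS'
    hiso hk hn

end NonSplit

end Summit.BirchSwinnertonDyer.Rank1Residual.X2

end
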